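import Literature.IUT.LogThetaLattice.TensorPacketsHermitian
import Literature.IUT.LogVolume.ArchimedeanPacketLogVolume
import Mathlib.Analysis.Convex.Basic
import Mathlib.Analysis.LocallyConvex.Basic
import HarnessLib

/-!
# [IUTchIII] Proposition 3.2 (ii), archimedean `v_ℚ`: convexity and log-volume of the Hermitian integral structure

PROOF-ONLY companion of `TensorPacketsHermitian.lean` (abc-iut-w4-d039): S. Mochizuki, *Inter-universal
Teichmüller theory III*, kurims manuscript (May 2020), Proposition 3.2 (ii), p. 98 l.−4 – p. 99 l.5 (node
**IUTchIII:Prop3.2(ii)**, archimedean case; locator per the RQ7 reads of p412100, 2026-08-25T23:43Z/23:52Z) — the closed unit ball `𝓘(^A𝒟^⊢_{v_ℚ}) ⊆ log(^A𝒟^⊢_{v_ℚ})` of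
"the induced tensor product Hermitian metric" (`hermitianBallN A V r`, with `B₀ = tensorForm` THE tensor
product metric of [IUTchIV] Prop. 1.5 (iii)) — and Proposition 3.9 (i)–(ii) pp. 115–116 (archimedean
log-volumes "normalized … so that the log-volume of [the integral structure] is `0`" up to the printed
comparison of [IUTchIV] Prop. 1.5 (iii)). Classical finite-dimensional analysis, no disputed input:

* `tensorForm_comm`, `tensorForm_sq_le` (Cauchy–Schwarz for `B₀` through its orthonormal coordinates),
  `abs_tensorForm_le_of_mem`;
* `convex_hermitianBallN`, `neg_mem_hermitianBallN`, `smul_mem_hermitianBallN`, `balanced_hermitianBallN`: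
  the Hermitian integral structure is a symmetric convex body (what "closed unit ball of a Hermitian
  metric" entails; used when hulls/containers are formed at archimedean places, [IUTchIII] Rmk. 3.9.5);
* in the normalised log-volume of abc-iut-L5-t7/S2's `ArchimedeanPacketLogVolume` (`packetLogVol Φ`,
  `B_I ↦ 0`, scaling by `c` adds `log|c|` — [IUTchIII] Prop. 3.9 (i) archimedean packet-normalization):
  **`packetLogVol_hermitianBallN_le`**: `μ^log(𝓘(^A𝒟^⊢_{v_ℚ})) ≤ |A|·log r + ((|A|−1)/2)·log 2` and
  **`le_packetLogVol_hermitianBallN`**: `|A|·log r − (1/2)·log(|V|^{|A|}) ≤ μ^log(𝓘(^A𝒟^⊢_{v_ℚ}))`, for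
  EVERY direct sum decomposition `Φ` — i.e. the log-volume of the Hermitian integral structure of
  [IUTchIII] Prop. 3.2 (ii) differs from that of [IUTchIV] Prop. 1.5 (iii)'s `B_I` by an explicit `O(|A|)`;
  with `r = π`, `|A| = j+1` the upper bound is [IUTchIV] Thm. 1.10 Step (vii)'s `(j+1)·log(π)` plus
  `(j/2)·log 2` (the factor `2^{|I|−1}` between the two metrics, Prop. 1.5 (iii)).

Record-only context: claim key `Mochizuki2012` (D-0012, disputed); nothing here takes a side on [IUTchIII]
Cor. 3.12; typed ≠ discharged.
-/

noncomputable section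

namespace Literature.IUT.LogThetaLattice

open scoped TensorProduct Pointwise ENNReal
open PiTensorProduct MeasureTheory Literature.IUT.LogVolume Literature.IUT.LogVolume.Prop15iii
  Literature.IUT.LogVolume.ArchPacket

variable {A V : Type} [Fintype A] [DecidableEq A] [Fintype V] [DecidableEq V]

/-! ### Cauchy–Schwarz for the tensor product metric; convexity and symmetry of the Hermitian ball -/

omit [DecidableEq V] in
/-- `B₀` is symmetric (`B₀(x,y) = Σ_p x_p y_p` in the orthonormal tensor basis).
[claim: Mochizuki2012, status: disputed] -/
theorem tensorForm_comm (x y : MI A V) : tensorForm A V x y = tensorForm A V y x := by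
  rw [tensorForm_apply, tensorForm_apply]
  exact Finset.sum_congr rfl fun p _ => mul_comm _ _

omit [DecidableEq V] in
/-- **Cauchy–Schwarz** for the tensor product metric: `B₀(x,y)² ≤ B₀(x,x)·B₀(y,y)` (coordinates in the
orthonormal tensor basis and the finite-sum Cauchy–Schwarz inequality). [claim: Mochizuki2012, status: disputed] -/
theorem tensorForm_sq_le (x y : MI A V) :
    tensorForm A V x y ^ 2 ≤ tensorForm A V x x * tensorForm A V y y := by
  simp only [tensorForm_apply]
  have h := Finset.sum_mul_sq_le_sq_mul_sq Finset.univ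
    (fun p => (basisMI A V).repr x p) (fun p => (basisMI A V).repr y p)
  simpa only [sq] using h

omit [DecidableEq V] in
/-- For `x, y ∈ 𝓘(^A𝒟^⊢_{v_ℚ})` (`B₀ ≤ c := (r²)^{|A|}` on both): `|B₀(x,y)| ≤ c`.
[claim: Mochizuki2012, status: disputed] -/
theorem abs_tensorForm_le_of_mem {r : ℝ} {x y : MPacketN ℝ (ArchComponents A V)}
    (hx : x ∈ hermitianBallN A V r) (hy : y ∈ hermitianBallN A V r) :
    |tensorForm A V x y| ≤ (r ^ 2) ^ Fintype.card A := by
  set c : ℝ := (r ^ 2) ^ Fintype.card A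
  have hc : 0 ≤ c := pow_nonneg (sq_nonneg r) _
  rw [mem_hermitianBallN_iff] at hx hy
  have h1 : |tensorForm A V x y| ≤ Real.sqrt (tensorForm A V x x * tensorForm A V y y) :=
    Real.abs_le_sqrt (tensorForm_sq_le x y)
  have h2 : Real.sqrt (tensorForm A V x x * tensorForm A V y y) ≤ Real.sqrt (c * c) :=
    Real.sqrt_le_sqrt (mul_le_mul hx hy (tensorForm_self_nonneg A V y) hc)
  rw [Real.sqrt_mul_self hc] at h2
  exact h1.trans h2

omit [DecidableEq V] in
/-- **The Hermitian integral structure `𝓘(^A𝒟^⊢_{v_ℚ})` is CONVEX** (a closed unit ball of a Hermitian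
metric: `B₀(ax+by, ax+by) = a²B₀(x,x) + 2ab·B₀(x,y) + b²B₀(y,y) ≤ (a+b)²·c = c` by Cauchy–Schwarz).
[claim: Mochizuki2012, status: disputed] -/
theorem convex_hermitianBallN (r : ℝ) : Convex ℝ (hermitianBallN A V r) := by
  intro x hx y hy a b ha hb hab
  have hBc : tensorForm A V x y ≤ (r ^ 2) ^ Fintype.card A :=
    (le_abs_self _).trans (abs_tensorForm_le_of_mem hx hy)
  rw [mem_hermitianBallN_iff] at hx hy ⊢
  have hexp : tensorForm A V (a • x + b • y) (a • x + b • y) =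
      a ^ 2 * tensorForm A V x x + 2 * a * b * tensorForm A V x y + b ^ 2 * tensorForm A V y y := by
    simp only [map_add, map_smul, LinearMap.add_apply, LinearMap.smul_apply, smul_eq_mul]
    rw [tensorForm_comm y x]
    ring
  rw [hexp]
  have hab2 : 0 ≤ 2 * a * b := by positivity
  calc a ^ 2 * tensorForm A V x x + 2 * a * b * tensorForm A V x y + b ^ 2 * tensorForm A V y y
      ≤ a ^ 2 * (r ^ 2) ^ Fintype.card A + 2 * a * b * (r ^ 2) ^ Fintype.card A +
          b ^ 2 * (r ^ 2) ^ Fintype.card A :=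
        add_le_add (add_le_add (mul_le_mul_of_nonneg_left hx (sq_nonneg a))
          (mul_le_mul_of_nonneg_left hBc hab2)) (mul_le_mul_of_nonneg_left hy (sq_nonneg b))
    _ = (a + b) ^ 2 * (r ^ 2) ^ Fintype.card A := by ring
    _ = (r ^ 2) ^ Fintype.card A := by rw [hab, one_pow, one_mul]

omit [DecidableEq V] in
/-- `𝓘(^A𝒟^⊢_{v_ℚ})` is symmetric: `x ∈ 𝓘 ⟹ −x ∈ 𝓘`. [claim: Mochizuki2012, status: disputed] -/
theorem neg_mem_hermitianBallN {r : ℝ} {x : MPacketN ℝ (ArchComponents A V)}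
    (hx : x ∈ hermitianBallN A V r) : -x ∈ hermitianBallN A V r := by
  rw [mem_hermitianBallN_iff] at hx ⊢
  simpa only [map_neg, LinearMap.neg_apply, neg_neg] using hx

omit [DecidableEq V] in
/-- `𝓘(^A𝒟^⊢_{v_ℚ})` is star-shaped/balanced: `|t| ≤ 1`, `x ∈ 𝓘 ⟹ t·x ∈ 𝓘` (`B₀(tx,tx) = t²B₀(x,x)`).
[claim: Mochizuki2012, status: disputed] -/
theorem smul_mem_hermitianBallN {r t : ℝ} (ht : |t| ≤ 1) {x : MPacketN ℝ (ArchComponents A V)}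
    (hx : x ∈ hermitianBallN A V r) : t • x ∈ hermitianBallN A V r := by
  rw [mem_hermitianBallN_iff] at hx ⊢
  rw [tensorForm_smul_smul]
  have ht2 : t ^ 2 ≤ 1 := by
    rw [← sq_abs]
    exact pow_le_one₀ (abs_nonneg t) ht
  calc t ^ 2 * tensorForm A V x x ≤ 1 * tensorForm A V x x :=
        mul_le_mul_of_nonneg_right ht2 (tensorForm_self_nonneg A V x)
    _ = tensorForm A V x x := one_mul _
    _ ≤ (r ^ 2) ^ Fintype.card A := hx

omit [DecidableEq V] in
/-- `𝓘(^A𝒟^⊢_{v_ℚ})` is balanced (Mathlib `Balanced ℝ`). [claim: Mochizuki2012, status: disputed] -/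
theorem balanced_hermitianBallN (r : ℝ) : Balanced ℝ (hermitianBallN A V r) := by
  intro t ht
  rintro _ ⟨x, hx, rfl⟩
  exact smul_mem_hermitianBallN (by simpa [Real.norm_eq_abs] using ht) hx

/-! ### The log-volume of the Hermitian integral structure, compared with `B_I` -/

section Volume

variable {J : Type} [Fintype J] [DecidableEq J]

omit [Fintype A] [DecidableEq A] [Fintype V] [DecidableEq V] [DecidableEq J] in
/-- In the coordinates of a decomposition `Φ`, `Φ(c·B_I) = c·B` has FINITE Lebesgue volume.
[claim: Mochizuki2012, status: disputed] -/
theorem volume_image_smul_ball_ne_top [Nonempty J] (Φ : Decomposition A V J) (c : ℝ) :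
    volume ((Φ : MI A V → (J → ℂ)) '' (c • ball Φ)) ≠ ∞ := by
  rw [image_smul_eq, image_ball, Measure.addHaar_smul]
  exact ENNReal.mul_ne_top ENNReal.ofReal_ne_top (volume_unitBall_lt_top J).ne

omit [Fintype A] [DecidableEq A] [Fintype V] [DecidableEq V] [DecidableEq J] in
/-- In the coordinates of `Φ`, `Φ(c·B_I)` has POSITIVE volume for `c ≠ 0` (`J ≠ ∅`).
[claim: Mochizuki2012, status: disputed] -/
theorem volume_image_smul_ball_ne_zero [Nonempty J] (Φ : Decomposition A V J) {c : ℝ} (hc : c ≠ 0) :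
    volume ((Φ : MI A V → (J → ℂ)) '' (c • ball Φ)) ≠ 0 := by
  rw [image_smul_eq, image_ball, Measure.addHaar_smul]
  refine mul_ne_zero ?_ (volume_unitBall_pos J).ne'
  exact (ENNReal.ofReal_pos.mpr (abs_pos.mpr (pow_ne_zero _ hc))).ne'

/-- If a decomposition with `J ≠ ∅` exists then `|V|^{|A|} > 0` (there are `2^{|A|−1}·|V|^{|A|}` copies).
[claim: Mochizuki2012, status: disputed] -/
theorem card_pow_card_pos [Nonempty J] (Φ : Decomposition A V J) :
    0 < (Fintype.card V : ℝ) ^ Fintype.card A := by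
  classical
  rcases isEmpty_or_nonempty A with hA | hA
  · exact (isEmpty_decomposition_of_isEmpty A V Φ).elim
  have hJ := card_eq_of_decomposition (I := A) (V := V) Φ
  have hpos : 0 < Fintype.card J := Fintype.card_pos
  rw [hJ] at hpos
  have hV : Fintype.card V ^ Fintype.card A ≠ 0 := (mul_ne_zero_iff.mp hpos.ne').2
  exact_mod_cast Nat.pos_of_ne_zero hV

/-- A shrunk copy of `B_I` sits inside the Hermitian ball: `s⁻¹·B_I ⊆ 𝓘(^A𝒟^⊢_{v_ℚ})`,
`s = √(|V|^{|A|})/r^{|A|}` (from `ball_subset_smul_hermitianBallN`). [claim: Mochizuki2012, status: disputed] -/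
theorem inv_smul_ball_subset_hermitianBallN [Nonempty J] {r : ℝ} (hr : 0 < r) (Φ : Decomposition A V J) :
    (Real.sqrt ((Fintype.card V : ℝ) ^ Fintype.card A) / r ^ Fintype.card A)⁻¹ • ball Φ ⊆
      hermitianBallN A V r := by
  have hs : 0 < Real.sqrt ((Fintype.card V : ℝ) ^ Fintype.card A) / r ^ Fintype.card A :=
    div_pos (Real.sqrt_pos.mpr (card_pow_card_pos Φ)) (pow_pos hr _)
  intro y hy
  obtain ⟨x, hx, rfl⟩ := hy
  obtain ⟨z, hz, rfl⟩ := ball_subset_smul_hermitianBallN hr Φ hx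
  show _ • _ • z ∈ hermitianBallN A V r
  rw [smul_smul, inv_mul_cancel₀ hs.ne', one_smul]
  exact hz

/-- The Hermitian ball has POSITIVE volume in the coordinates of any `Φ` (`J ≠ ∅`).
[claim: Mochizuki2012, status: disputed] -/
theorem volume_image_hermitianBallN_ne_zero [Nonempty J] {r : ℝ} (hr : 0 < r) (Φ : Decomposition A V J) :
    volume ((Φ : MI A V → (J → ℂ)) '' hermitianBallN A V r) ≠ 0 := by
  have hs : (Real.sqrt ((Fintype.card V : ℝ) ^ Fintype.card A) / r ^ Fintype.card A)⁻¹ ≠ 0 :=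
    inv_ne_zero (div_pos (Real.sqrt_pos.mpr (card_pow_card_pos Φ)) (pow_pos hr _)).ne'
  exact fun h => volume_image_smul_ball_ne_zero Φ hs
    (measure_mono_null (Set.image_mono (inv_smul_ball_subset_hermitianBallN hr Φ)) h)

omit [DecidableEq V] [DecidableEq J] in
/-- The Hermitian ball has FINITE volume in the coordinates of any `Φ`.
[claim: Mochizuki2012, status: disputed] -/
theorem volume_image_hermitianBallN_ne_top [Nonempty J] {r : ℝ} (hr : 0 < r) (Φ : Decomposition A V J) :
    volume ((Φ : MI A V → (J → ℂ)) '' hermitianBallN A V r) ≠ ∞ :=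
  ne_top_of_le_ne_top (volume_image_smul_ball_ne_top Φ _)
    (measure_mono (Set.image_mono (hermitianBallN_subset_smul_ball hr Φ)))

omit [DecidableEq V] [DecidableEq J] in
/-- **Upper bound** ([IUTchIII] Prop. 3.9 (i)–(ii) archimedean log-volume vs [IUTchIV] Prop. 1.5 (iii)):
for EVERY decomposition `Φ` (`J ≠ ∅`), `μ^log_Φ(𝓘(^A𝒟^⊢_{v_ℚ})) ≤ log(√(2^{|A|−1})·r^{|A|})
= |A|·log r + ((|A|−1)/2)·log 2` — monotonicity over `𝓘 ⊆ (√(2^{|A|−1})·r^{|A|})·B_I` and `μ^log(B_I) = 0`.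
[claim: Mochizuki2012, status: disputed] -/
theorem packetLogVol_hermitianBallN_le [Nonempty J] {r : ℝ} (hr : 0 < r) (Φ : Decomposition A V J) :
    packetLogVol Φ (hermitianBallN A V r) ≤
      Fintype.card A * Real.log r + ((Fintype.card A - 1 : ℕ) : ℝ) / 2 * Real.log 2 := by
  classical
  set c : ℝ := Real.sqrt (2 ^ (Fintype.card A - 1)) * r ^ Fintype.card A with hc_def
  have h2pos : (0 : ℝ) < 2 ^ (Fintype.card A - 1) := pow_pos two_pos _
  have hc : 0 < c := mul_pos (Real.sqrt_pos.mpr h2pos) (pow_pos hr _)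
  have hmono : packetLogVol Φ (hermitianBallN A V r) ≤ packetLogVol Φ (c • ball Φ) :=
    nlogVol_mono J (Set.image_mono (hermitianBallN_subset_smul_ball hr Φ))
      (volume_image_hermitianBallN_ne_zero hr Φ) (volume_image_smul_ball_ne_top Φ c)
  have hval : packetLogVol Φ (c • ball Φ) = Real.log c := by
    rw [packetLogVol_smul Φ hc.ne', packetLogVol_ball, add_zero, abs_of_pos hc]
    · rw [image_ball]; exact (volume_unitBall_pos J).ne'
    · rw [image_ball]; exact (volume_unitBall_lt_top J).ne
  have hlog : Real.log c =
      Fintype.card A * Real.log r + ((Fintype.card A - 1 : ℕ) : ℝ) / 2 * Real.log 2 := by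
    rw [hc_def, Real.log_mul (Real.sqrt_pos.mpr h2pos).ne' (pow_pos hr _).ne', Real.log_sqrt h2pos.le,
      Real.log_pow, Real.log_pow]
    ring
  exact hmono.trans (hval.trans hlog).le

/-- **Lower bound**: for EVERY decomposition `Φ` (`J ≠ ∅`),
`log(r^{|A|}/√(|V|^{|A|})) = |A|·log r − (1/2)·log(|V|^{|A|}) ≤ μ^log_Φ(𝓘(^A𝒟^⊢_{v_ℚ}))` — monotonicity
over `s⁻¹·B_I ⊆ 𝓘`. Together with the upper bound: the log-volume of the Hermitian integral structure is
within an explicit `O(|A|·(1 + log|V|))` of that of `B_I` (`= 0`). [claim: Mochizuki2012, status: disputed] -/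
theorem le_packetLogVol_hermitianBallN [Nonempty J] {r : ℝ} (hr : 0 < r) (Φ : Decomposition A V J) :
    Fintype.card A * Real.log r - Real.log ((Fintype.card V : ℝ) ^ Fintype.card A) / 2 ≤
      packetLogVol Φ (hermitianBallN A V r) := by
  set N : ℝ := (Fintype.card V : ℝ) ^ Fintype.card A with hN_def
  have hN : 0 < N := card_pow_card_pos Φ
  set s : ℝ := Real.sqrt N / r ^ Fintype.card A with hs_def
  have hs : 0 < s := div_pos (Real.sqrt_pos.mpr hN) (pow_pos hr _)
  have hmono : packetLogVol Φ (s⁻¹ • ball Φ) ≤ packetLogVol Φ (hermitianBallN A V r) :=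
    nlogVol_mono J (Set.image_mono (inv_smul_ball_subset_hermitianBallN hr Φ))
      (volume_image_smul_ball_ne_zero Φ (inv_ne_zero hs.ne')) (volume_image_hermitianBallN_ne_top hr Φ)
  have hval : packetLogVol Φ (s⁻¹ • ball Φ) = Real.log s⁻¹ := by
    rw [packetLogVol_smul Φ (inv_ne_zero hs.ne'), packetLogVol_ball, add_zero, abs_of_pos (inv_pos.mpr hs)]
    · rw [image_ball]; exact (volume_unitBall_pos J).ne'
    · rw [image_ball]; exact (volume_unitBall_lt_top J).ne
  have hlog : Real.log s⁻¹ = Fintype.card A * Real.log r - Real.log N / 2 := by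
    rw [Real.log_inv, hs_def, Real.log_div (Real.sqrt_pos.mpr hN).ne' (pow_pos hr _).ne',
      Real.log_sqrt hN.le, Real.log_pow, Real.log_pow]
    ring
  exact (hlog.symm.le.trans hval.symm.le).trans hmono

end Volume

end Literature.IUT.LogThetaLattice

end
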